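import Literature.NumberTheory.IwasawaTheory.SinnottNormGlobalUnit
import Mathlib.NumberTheory.Cyclotomic.Gal
import HarnessLib

/-!
# The DISTRIBUTION RELATION for Sinnott's norm elements: `N_{ℚ(μ_{tm})/k}(1 − ζ_{tm}) = N_{ℚ(μ_t)/k}(1 − ζ_t)` for
# `k ⊆ ℚ(ζ_t)` when every prime of `m` divides `t` — proved, no named fact

Topic `NumberTheory/IwasawaTheory`; namespace `Literature.NumberTheory.IwasawaTheory.CyclotomicUnits` (continues F4's
`CyclotomicColemanMap.lean` §1: `sinnottExponents k ζ`, `sinnottNorm k ζ a = ∏_{b ∈ sinnottExponents k ζ} (1 − ζ^{ab})`, and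
`SinnottNormGlobalUnit.lean`).  Cell bsd-cm, seat bsd-cm-k-ty1 g24 (literature-prover), serving `stmt-BirchSwinnertonDyer-19945`
(the `𝒞₇` genus road: input (3b′) of the K1ᵘ genus datum — the global norm relation `N_{K_{n'}/K_n}(ξ_{n'}) = ξ_n` of the
Sinnott family `ξ_n = N_{ℚ(ζ_{7^{n+1}|D|})/K_n}(1 − ζ_{7^{n+1}|D|})` splits as TRANSITIVITY `N_{K_{n'}/K_n} ∘ N_{ℚ(ζ')/K_{n'}} =
N_{ℚ(ζ')/K_n}` and the DISTRIBUTION RELATION proved here, `N_{ℚ(ζ')/K_n}(1 − ζ') = N_{ℚ(ζ)/K_n}(1 − ζ)`).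

WHY / WHAT.  For `t' = t·m` with every prime factor of `m` dividing `t`, a primitive `t'`-th root of unity `ζ'` and
`ζ = ζ'^m`, and a subfield `k ⊆ ℚ(ζ) ⊆ ℚ̄`:
* §1 `exists_algEquiv_apply_eq_pow` — every unit `c mod t'` is realised by an automorphism of `ℚ̄`: `σ ζ' = ζ'^c`
  (irreducibility of `Φ_{t'}` over `ℚ`: Mathlib `IsCyclotomicExtension.fromZetaAut` on `ℚ(ζ') ⊆ ℚ̄`, lifted to `ℚ̄` by
  `AlgEquiv.liftNormal`); `algEquiv_apply_eq_of_apply_eq` — automorphisms agreeing on `ζ` agree on `ℚ(ζ)`.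
* §2 `mem_sinnottExponents_iff_of_le_adjoin` — the exponent set at level `t'` is the full preimage of the exponent set at
  level `t`: `c ∈ sinnottExponents k ζ' ↔ (c.val : ZMod t) ∈ sinnottExponents k ζ` (`k ⊆ ℚ(ζ)`; units lift to units since
  `rad t' = rad t`).
* §3 ★ `sinnottNorm_eq_sinnottNorm_pow` — THE DISTRIBUTION RELATION `sinnottNorm k ζ' 1 = sinnottNorm k (ζ'^m) 1`, i.e.
  `∏_{c ∈ S'} (1 − ζ'^c) = ∏_{b ∈ S} ∏_{j<m} (1 − ζ'^{b+tj}) = ∏_{b ∈ S} (1 − ζ^b)` by `∏_{j<m} (1 − ω^j x) = 1 − x^m`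
  (`ω = ζ'^t`, F3 `CyclotomicUnits.prod_one_sub_pow_mul_eq`).
* §4 along the tower `K_n = F₀ ⊔ ℚ(μ_{p^{n+1}})`, `F₀ ⊆ ℚ(μ_{m'})`, compatible roots `ζ_{n+1}^p = ζ_n`:
  `cyclotomicLayer_le_adjoin` (`K_n ⊆ ℚ(ζ_n)`) and ★ `sinnottNorm_succ_eq_sinnottNorm`:
  `sinnottNorm (p^{n+2}m') K_n ζ_{n+1} 1 = sinnottNorm (p^{n+1}m') K_n ζ_n 1` — for the genus frame (`p = 7`, `m' = |D|`,
  `F₀ = ℚ(√D) ⊆ ℚ(μ_{|D|})`): `N_{ℚ(ζ_{n+1})/K_n}(1 − ζ_{n+1}) = ξ_n`, the distribution half of «`N_{K_{n+1}/K_n} ξ_{n+1} = ξ_n`».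

PRINT. S. Lang, *Cyclotomic Fields I–II* (1990), Ch. 6 §1–§2 (distribution relations of the cyclotomic units: `N_{ℚ(μ_{nm})/ℚ(μ_n)}
(1 − ζ_{nm}) = 1 − ζ_n` when every prime of `m` divides `n`); L. Washington, *Introduction to Cyclotomic Fields* (1997) Prop. 2.8 /
Lemma 8.1 context; T. Tsuji, J. Number Theory 78 (1999) §6 (p. 20: Sinnott's `D_k`, the norms `N_{ℚ(μ_t)/ℚ(μ_t) ∩ k}(1 − ζ_t^a)`).
All theorems; no definition, no instance, no named fact.  HONEST FRAMING: a cyclotomic-unit identity; nothing about BSD.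

## References
* [Lang1990] S. Lang, *Cyclotomic Fields I and II*, GTM 121 (1990), Ch. 6 §1–§2.
* [Washington1997] L. C. Washington, *Introduction to Cyclotomic Fields*, 2nd ed., GTM 83 (1997), Ch. 8 §1.
* [Tsuji1999] T. Tsuji, Semi-local units modulo cyclotomic units, J. Number Theory 78 (1999) 1–26, §6 (p. 20).
-/

noncomputable section

open Polynomial Field
open Literature.NumberTheory.ComplexMultiplication.EllipticUnits

namespace Literature.NumberTheory.IwasawaTheory

namespace CyclotomicUnits

variable (k : IntermediateField ℚ (AlgebraicClosure ℚ))

/-! ### §1. Units are realised by automorphisms of `ℚ̄`; automorphisms agreeing on `ζ` agree on `ℚ(ζ)` -/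

/-- **Every unit exponent is a Galois conjugation**: for a primitive `t`-th root of unity `ζ ∈ ℚ̄` and `c` prime to `t` there is
an automorphism `σ` of `ℚ̄` with `σ ζ = ζ^c` (`Φ_t` is irreducible over `ℚ`; lift from `ℚ(ζ)` to `ℚ̄`).
[cite: Washington1997, Thm. 2.5 (Gal(ℚ(ζ_n)/ℚ) ≅ (ℤ/nℤ)^×)] [cite: Lang1990, Ch. 6 §1] -/
theorem exists_algEquiv_apply_eq_pow {t : ℕ} (ht : 0 < t) {ζ : AlgebraicClosure ℚ} (hζ : IsPrimitiveRoot ζ t) {c : ℕ}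
    (hc : c.Coprime t) : ∃ σ : AlgebraicClosure ℚ ≃ₐ[ℚ] AlgebraicClosure ℚ, σ ζ = ζ ^ c := by
  haveI : NeZero t := ⟨ht.ne'⟩
  haveI hII : Algebra.IsIntegral ℚ (AlgebraicClosure ℚ) :=
    @Algebra.IsAlgebraic.isIntegral ℚ (AlgebraicClosure ℚ) _ _ (AlgebraicClosure.instAlgebra ℚ)
      (AlgebraicClosure.isAlgebraic (k := ℚ))
  haveI hN : Normal ℚ (AlgebraicClosure ℚ) :=
    @IsAlgClosure.normal ℚ (AlgebraicClosure ℚ) _ _ (AlgebraicClosure.instAlgebra ℚ)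
      (inferInstance : @IsAlgClosure ℚ (AlgebraicClosure ℚ) _ _ (AlgebraicClosure.instAlgebra ℚ) _)
  haveI hcyc : IsCyclotomicExtension {t} ℚ (IntermediateField.adjoin ℚ {ζ}) :=
    IsPrimitiveRoot.intermediateField_adjoin_isCyclotomicExtension ℚ hζ
  have hirr : Irreducible (cyclotomic t ℚ) := cyclotomic.irreducible_rat ht
  have hζL : IsPrimitiveRoot (IntermediateField.AdjoinSimple.gen ℚ ζ) t :=
    IsPrimitiveRoot.coe_submonoidClass_iff.mp (by rw [IntermediateField.AdjoinSimple.coe_gen]; exact hζ)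
  -- `gen = zeta ^ e`, and the automorphism `zeta ↦ zeta ^ c`
  obtain ⟨e, -, he⟩ := (IsCyclotomicExtension.zeta_spec t ℚ (IntermediateField.adjoin ℚ {ζ})).eq_pow_of_pow_eq_one
    hζL.pow_eq_one
  have hμ : IsPrimitiveRoot (IsCyclotomicExtension.zeta t ℚ (IntermediateField.adjoin ℚ {ζ}) ^ c) t :=
    (IsCyclotomicExtension.zeta_spec t ℚ _).pow_of_coprime c hc
  set τ : IntermediateField.adjoin ℚ {ζ} ≃ₐ[ℚ] IntermediateField.adjoin ℚ {ζ} :=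
    IsCyclotomicExtension.fromZetaAut hμ hirr with hτdef
  have hτ : τ (IsCyclotomicExtension.zeta t ℚ (IntermediateField.adjoin ℚ {ζ})) =
      IsCyclotomicExtension.zeta t ℚ (IntermediateField.adjoin ℚ {ζ}) ^ c :=
    IsCyclotomicExtension.fromZetaAut_spec hμ hirr
  have hτζ : τ (IntermediateField.AdjoinSimple.gen ℚ ζ) = IntermediateField.AdjoinSimple.gen ℚ ζ ^ c := by
    rw [← he, map_pow, hτ, ← pow_mul, mul_comm, pow_mul]
  refine ⟨τ.liftNormal (AlgebraicClosure ℚ), ?_⟩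
  have h := AlgEquiv.liftNormal_commutes τ (AlgebraicClosure ℚ) (IntermediateField.AdjoinSimple.gen ℚ ζ)
  rw [hτζ, map_pow, IntermediateField.AdjoinSimple.algebraMap_gen] at h
  exact h

/-- Automorphisms of `ℚ̄` that agree on `ζ` agree on `ℚ(ζ)`. [cite: Lang1990, Ch. 6 §1] -/
theorem algEquiv_apply_eq_of_apply_eq {ζ : AlgebraicClosure ℚ} (σ τ : AlgebraicClosure ℚ ≃ₐ[ℚ] AlgebraicClosure ℚ)
    (hστ : σ ζ = τ ζ) {x : AlgebraicClosure ℚ} (hx : x ∈ IntermediateField.adjoin ℚ {ζ}) : σ x = τ x := by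
  have hζmem : ζ ∈ IntermediateField.fixedField (Subgroup.zpowers (τ⁻¹ * σ)) := by
    rw [IntermediateField.mem_fixedField_iff]
    have hρ : (τ⁻¹ * σ) ζ = ζ := by rw [AlgEquiv.mul_apply, hστ, AlgEquiv.aut_inv, AlgEquiv.symm_apply_apply]
    have hle : Subgroup.zpowers (τ⁻¹ * σ) ≤ MulAction.stabilizer (AlgebraicClosure ℚ ≃ₐ[ℚ] AlgebraicClosure ℚ) ζ :=
      (Subgroup.zpowers_le (H := MulAction.stabilizer _ ζ)).mpr (MulAction.mem_stabilizer_iff.mpr hρ)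
    exact fun f hf => MulAction.mem_stabilizer_iff.mp (hle hf)
  have hmem := (IntermediateField.adjoin_simple_le_iff.mpr hζmem) hx
  rw [IntermediateField.mem_fixedField_iff] at hmem
  have h := hmem (τ⁻¹ * σ) (Subgroup.mem_zpowers _)
  rw [AlgEquiv.mul_apply, AlgEquiv.aut_inv, AlgEquiv.symm_apply_eq] at h
  exact h

/-! ### §2. The exponent sets along `ζ' ↦ ζ = ζ'^m` -/

/-- If every prime factor of `t' ` divides `t`, an integer prime to `t` is prime to `t'`. [cite: Lang1990, Ch. 6 §1] -/
theorem coprime_of_coprime_of_forall_prime_dvd {t t' : ℕ} (hrad : ∀ q : ℕ, q.Prime → q ∣ t' → q ∣ t) {c : ℕ}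
    (hc : c.Coprime t) : c.Coprime t' :=
  Nat.coprime_of_dvd fun q hq hqc hqt' => by
    have h1 : q ∣ Nat.gcd c t := Nat.dvd_gcd hqc (hrad q hq hqt')
    rw [hc] at h1
    exact hq.one_lt.ne' (Nat.dvd_one.mp h1)

/-- For `b ∈ sinnottExponents k ζ`, `b` is a unit exponent: `b.val` is prime to `t`. [cite: Tsuji1999, §6 (p. 20)] -/
theorem coprime_of_mem_sinnottExponents {t : ℕ} (ht : 0 < t) {ζ : AlgebraicClosure ℚ} (hζ : IsPrimitiveRoot ζ t)
    {b : ZMod t} (hb : b ∈ sinnottExponents (t := t) k ζ) : b.val.Coprime t := by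
  haveI : NeZero t := ⟨ht.ne'⟩
  obtain ⟨σ, -, hσ⟩ := (mem_sinnottExponents_iff k ζ b).mp hb
  have hprim : IsPrimitiveRoot (ζ ^ b.val) t := by
    rw [← hσ]
    exact hζ.map_of_injective (absoluteGaloisGroup.toAlgEquiv ℚ σ).injective
  exact (hζ.pow_iff_coprime ht b.val).mp hprim

/-- **The exponent set at level `t' = t·m` is the preimage of the exponent set at level `t`** (`k ⊆ ℚ(ζ)`, `ζ = ζ'^m`, every
prime of `t'` divides `t`): `c ∈ sinnottExponents k ζ' ↔ (c.val : ZMod t) ∈ sinnottExponents k ζ`.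
[cite: Lang1990, Ch. 6 §1–§2] [cite: Tsuji1999, §6 (p. 20)] -/
theorem mem_sinnottExponents_iff_of_le_adjoin {t m : ℕ} (ht : 0 < t) (hm : 0 < m)
    (hrad : ∀ q : ℕ, q.Prime → q ∣ t * m → q ∣ t) {ζ' : AlgebraicClosure ℚ} (hζ' : IsPrimitiveRoot ζ' (t * m))
    (hk : k ≤ IntermediateField.adjoin ℚ {ζ' ^ m}) (c : ZMod (t * m)) :
    c ∈ sinnottExponents (t := t * m) k ζ' ↔ (c.val : ZMod t) ∈ sinnottExponents (t := t) k (ζ' ^ m) := by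
  haveI : NeZero (t * m) := ⟨(Nat.mul_pos ht hm).ne'⟩
  haveI : NeZero t := ⟨ht.ne'⟩
  have hζ : IsPrimitiveRoot (ζ' ^ m) t := hζ'.pow (Nat.mul_pos ht hm) (mul_comm t m)
  constructor
  · rintro hc
    obtain ⟨σ, hσk, hσ⟩ := (mem_sinnottExponents_iff k ζ' c).mp hc
    refine (mem_sinnottExponents_iff k (ζ' ^ m) _).mpr ⟨σ, hσk, ?_⟩
    rw [map_pow, hσ, ← pow_mul, mul_comm, pow_mul, ZMod.val_natCast, ← pow_mod_eq_pow hζ c.val]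
  · intro hc
    -- `c` is a unit mod `t m`: realise it by `σ`, which fixes `k ⊆ ℚ(ζ)` because it acts on `ζ` like a `k`-fixing `τ`
    obtain ⟨τ, hτk, hτζ⟩ := (mem_sinnottExponents_iff k (ζ' ^ m) _).mp hc
    rw [ZMod.val_natCast, pow_mod_eq_pow hζ] at hτζ
    have hcop : c.val.Coprime (t * m) := by
      have h1 : (c.val : ZMod t).val.Coprime t := coprime_of_mem_sinnottExponents k ht hζ hc
      rw [ZMod.val_natCast] at h1
      have h2 : c.val.Coprime t := by
        rw [Nat.coprime_comm, Nat.Coprime, Nat.gcd_rec]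
        exact h1
      exact coprime_of_coprime_of_forall_prime_dvd hrad h2
    obtain ⟨σ, hσ⟩ := exists_algEquiv_apply_eq_pow (Nat.mul_pos ht hm) hζ' hcop
    have hσζ : σ (ζ' ^ m) = absoluteGaloisGroup.toAlgEquiv ℚ τ (ζ' ^ m) := by
      rw [hτζ, map_pow, hσ, ← pow_mul, mul_comm, pow_mul]
    refine (mem_sinnottExponents_iff k ζ' c).mpr ⟨(absoluteGaloisGroup.toAlgEquiv ℚ).symm σ, fun x hx => ?_, ?_⟩
    · rw [MulEquiv.apply_symm_apply]
      exact (algEquiv_apply_eq_of_apply_eq σ _ hσζ (hk hx)).trans (hτk x hx)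
    · rw [MulEquiv.apply_symm_apply]
      exact hσ

/-! ### §3. The distribution relation -/

/-- ★ **THE DISTRIBUTION RELATION for Sinnott's norm elements**: for `t' = t·m` with every prime of `t'` dividing `t`, a
primitive `t'`-th root of unity `ζ'` and `k ⊆ ℚ(ζ'^m)`:
`N_{ℚ(μ_{t'})/ℚ(μ_{t'}) ∩ k}(1 − ζ') = N_{ℚ(μ_t)/ℚ(μ_t) ∩ k}(1 − ζ'^m)`, i.e. `sinnottNorm k ζ' 1 = sinnottNorm k (ζ'^m) 1`
(group the exponents `c = b + tj`, `j < m`, over `b ∈ sinnottExponents k (ζ'^m)` and use `∏_{j<m}(1 − ω^j x) = 1 − x^m`).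
[cite: Lang1990, Ch. 6 §1–§2 (distribution relations of cyclotomic units)] [cite: Tsuji1999, §6 (p. 20)] -/
theorem sinnottNorm_eq_sinnottNorm_pow {t m t' : ℕ} (ht : 0 < t) (hm : 0 < m) (ht' : t' = t * m)
    (hrad : ∀ q : ℕ, q.Prime → q ∣ t' → q ∣ t) {ζ' : AlgebraicClosure ℚ} (hζ' : IsPrimitiveRoot ζ' t')
    (hk : k ≤ IntermediateField.adjoin ℚ {ζ' ^ m}) :
    sinnottNorm (t := t') k ζ' 1 = sinnottNorm (t := t) k (ζ' ^ m) 1 := by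
  subst ht'
  classical
  haveI : NeZero (t * m) := ⟨(Nat.mul_pos ht hm).ne'⟩
  haveI : NeZero t := ⟨ht.ne'⟩
  have hω : IsPrimitiveRoot (ζ' ^ t) m := hζ'.pow (Nat.mul_pos ht hm) rfl
  -- the lift `(b, j) ↦ b + t j`
  have hval : ∀ (b : ZMod t) (j : ℕ), j < m → (((b.val + t * j : ℕ) : ZMod (t * m))).val = b.val + t * j := by
    intro b j hj
    rw [ZMod.val_natCast, Nat.mod_eq_of_lt]
    calc b.val + t * j < t + t * j := Nat.add_lt_add_right (ZMod.val_lt b) _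
      _ = t * (j + 1) := by ring
      _ ≤ t * m := Nat.mul_le_mul_left t hj
  have hred : ∀ (b : ZMod t) (j : ℕ), j < m → ((((b.val + t * j : ℕ) : ZMod (t * m))).val : ZMod t) = b := by
    intro b j hj
    rw [hval b j hj, Nat.cast_add, Nat.cast_mul, ZMod.natCast_zmod_val, ZMod.natCast_self, zero_mul, add_zero]
  rw [sinnottNorm, sinnottNorm, finprod_mem_eq_finite_toFinset_prod _ (Set.toFinite _),
    finprod_mem_eq_finite_toFinset_prod _ (Set.toFinite _)]
  simp only [one_mul]
  have himage : (Set.toFinite (sinnottExponents (t := t * m) k ζ')).toFinset =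
      ((Set.toFinite (sinnottExponents (t := t) k (ζ' ^ m))).toFinset ×ˢ Finset.range m).image
        (fun p : ZMod t × ℕ => ((p.1.val + t * p.2 : ℕ) : ZMod (t * m))) := by
    ext c
    simp only [Set.Finite.mem_toFinset, Finset.mem_image, Finset.mem_product, Finset.mem_range, Prod.exists]
    constructor
    · intro hc
      refine ⟨(c.val : ZMod t), c.val / t, ⟨(mem_sinnottExponents_iff_of_le_adjoin k ht hm hrad hζ' hk c).mp hc,
        (Nat.div_lt_iff_lt_mul ht).mpr (lt_of_lt_of_eq (ZMod.val_lt c) (mul_comm t m))⟩, ?_⟩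
      rw [ZMod.val_natCast, Nat.mod_add_div, ZMod.natCast_zmod_val]
    · rintro ⟨b, j, ⟨hb, hj⟩, rfl⟩
      exact (mem_sinnottExponents_iff_of_le_adjoin k ht hm hrad hζ' hk _).mpr (by rw [hred b j hj]; exact hb)
  have hinj : Set.InjOn (fun p : ZMod t × ℕ => ((p.1.val + t * p.2 : ℕ) : ZMod (t * m)))
      ↑((Set.toFinite (sinnottExponents (t := t) k (ζ' ^ m))).toFinset ×ˢ Finset.range m) := by
    rintro ⟨b, j⟩ hbj ⟨b', j'⟩ hbj' h
    simp only [Finset.coe_product, Set.mem_prod, Finset.mem_coe, Finset.mem_range] at hbj hbj'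
    have hv : b.val + t * j = b'.val + t * j' := by
      have := congrArg ZMod.val h
      rwa [hval b j hbj.2, hval b' j' hbj'.2] at this
    have h1 : b.val = b'.val := by
      have := congrArg (· % t) hv
      simp only [Nat.add_mul_mod_self_left, Nat.mod_eq_of_lt (ZMod.val_lt b), Nat.mod_eq_of_lt (ZMod.val_lt b')] at this
      exact this
    have h2 : j = j' := by
      have := congrArg (· / t) hv
      simp only [Nat.add_mul_div_left _ _ ht, Nat.div_eq_of_lt (ZMod.val_lt b), Nat.div_eq_of_lt (ZMod.val_lt b'),
        zero_add] at this
      exact this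
    rw [ZMod.val_injective t h1, h2]
  rw [himage, Finset.prod_image hinj, Finset.prod_product]
  refine Finset.prod_congr rfl fun b hb => ?_
  have hterm : ∀ j ∈ Finset.range m,
      (1 - ζ' ^ (((b.val + t * j : ℕ) : ZMod (t * m))).val) = 1 - (ζ' ^ t) ^ j * ζ' ^ b.val := by
    intro j hj
    rw [hval b j (Finset.mem_range.mp hj), pow_add, pow_mul, mul_comm]
  rw [Finset.prod_congr rfl hterm, prod_one_sub_pow_mul_eq hm hω, ← pow_mul, ← pow_mul, mul_comm]

/-! ### §4. Along the tower `K_n = F₀(μ_{p^{n+1}})` with a compatible system of roots of unity -/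

/-- **`K_n = F₀ ⊔ ℚ(μ_{p^{n+1}}) ⊆ ℚ(ζ_n)`** for `F₀ ⊆ ℚ(μ_{m'})` and `ζ_n` a primitive `p^{n+1}m'`-th root of unity (the roots of
unity of orders `m'` and `p^{n+1}` are powers of `ζ_n`). [cite: Tsuji1999, §6 (p. 20, «k ⊆ ℚ(μ_t)»)] [cite: Lang1990, Ch. 6 §1] -/
theorem cyclotomicLayer_le_adjoin (F₀ : IntermediateField ℚ (AlgebraicClosure ℚ)) {m' p : ℕ} (hp : p.Prime) (hm' : 0 < m')
    (hF₀ : F₀ ≤ IntermediateField.adjoin ℚ {x : AlgebraicClosure ℚ | x ^ m' = 1}) {ζ : ℕ → AlgebraicClosure ℚ}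
    (hζ : IsCompatibleRootSystem m' p ζ) (n : ℕ) :
    cyclotomicLayer F₀ p n ≤ IntermediateField.adjoin ℚ {ζ n} := by
  have hpos : 0 < p ^ (n + 1) * m' := Nat.mul_pos (pow_pos hp.pos _) hm'
  haveI : NeZero m' := ⟨hm'.ne'⟩
  haveI : NeZero (p ^ (n + 1)) := ⟨(pow_pos hp.pos _).ne'⟩
  -- the roots of unity of orders `m'` and `p^{n+1}` inside `ℚ(ζ_n)`
  have hω : IsPrimitiveRoot (ζ n ^ p ^ (n + 1)) m' := (hζ.1 n).pow hpos rfl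
  have hω' : IsPrimitiveRoot (ζ n ^ m') (p ^ (n + 1)) := (hζ.1 n).pow hpos (mul_comm _ _)
  have hmem : ∀ (e i : ℕ), (ζ n ^ e) ^ i ∈ IntermediateField.adjoin ℚ {ζ n} := fun e i =>
    pow_mem (pow_mem (IntermediateField.mem_adjoin_simple_self ℚ (ζ n)) e) i
  rw [cyclotomicLayer_def]
  refine sup_le (hF₀.trans (IntermediateField.adjoin_le_iff.mpr fun x hx => ?_))
    (IntermediateField.adjoin_le_iff.mpr fun x hx => ?_)
  · obtain ⟨i, -, hi⟩ := hω.eq_pow_of_pow_eq_one hx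
    rw [← hi]
    exact hmem _ i
  · obtain ⟨i, -, hi⟩ := hω'.eq_pow_of_pow_eq_one hx
    rw [← hi]
    exact hmem _ i

/-- ★ **The distribution relation along the tower**: for `F₀ ⊆ ℚ(μ_{m'})`, a prime `p` and a compatible system `ζ` of primitive
`p^{n+1}m'`-th roots of unity (`ζ_{n+1}^p = ζ_n`), Sinnott's norm elements of `K_n = F₀ ⊔ ℚ(μ_{p^{n+1}})` at the two levels agree:
`N_{ℚ(ζ_{n+1})/ℚ(ζ_{n+1}) ∩ K_n}(1 − ζ_{n+1}) = N_{ℚ(ζ_n)/ℚ(ζ_n) ∩ K_n}(1 − ζ_n)` — the distribution half of the norm relation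
`N_{K_{n+1}/K_n}(ξ_{n+1}) = ξ_n` of the Sinnott family (the other half is transitivity of norms).
[cite: Lang1990, Ch. 6 §1–§2] [cite: Tsuji1999, §6 (6.1) (p. 21)] -/
theorem sinnottNorm_succ_eq_sinnottNorm (F₀ : IntermediateField ℚ (AlgebraicClosure ℚ)) {m' p : ℕ} (hp : p.Prime)
    (hm' : 0 < m') (hF₀ : F₀ ≤ IntermediateField.adjoin ℚ {x : AlgebraicClosure ℚ | x ^ m' = 1})
    {ζ : ℕ → AlgebraicClosure ℚ} (hζ : IsCompatibleRootSystem m' p ζ) (n : ℕ) :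
    sinnottNorm (t := p ^ (n + 2) * m') (cyclotomicLayer F₀ p n) (ζ (n + 1)) 1 =
      sinnottNorm (t := p ^ (n + 1) * m') (cyclotomicLayer F₀ p n) (ζ n) 1 := by
  have ht : 0 < p ^ (n + 1) * m' := Nat.mul_pos (pow_pos hp.pos _) hm'
  have ht' : p ^ (n + 2) * m' = p ^ (n + 1) * m' * p := by ring
  have hrad : ∀ q : ℕ, q.Prime → q ∣ p ^ (n + 2) * m' → q ∣ p ^ (n + 1) * m' := by
    intro q hq hdvd
    rw [ht'] at hdvd
    rcases (Nat.Prime.dvd_mul hq).mp hdvd with h | h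
    · exact h
    · have hqp : q = p := (Nat.prime_dvd_prime_iff_eq hq hp).mp h
      rw [hqp, pow_succ]
      exact Dvd.dvd.mul_right (Dvd.intro_left _ rfl) _
  have hk : cyclotomicLayer F₀ p n ≤ IntermediateField.adjoin ℚ {ζ (n + 1) ^ p} := by
    rw [hζ.2 n]
    exact cyclotomicLayer_le_adjoin F₀ hp hm' hF₀ hζ n
  rw [← hζ.2 n]
  exact sinnottNorm_eq_sinnottNorm_pow (cyclotomicLayer F₀ p n) ht hp.pos ht' hrad (hζ.1 (n + 1)) hk

end CyclotomicUnits

end Literature.NumberTheory.IwasawaTheory
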